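import Literature.Analysis.Asymptotics.MonomialAmplitudeMoments
import HarnessLib

/-!
# Finite sums of functions with power-log asymptotics: the dominant scale wins

Bookkeeping step of the gluing argument in the asymptotic theory of Laplace integrals /
sublevel volumes (Arnold–Gusein-Zade–Varchenko II §7.3, proof of Thm. 7.5: the oscillation index
of a sum of elementary integrals is the maximum of the indices of the pieces; Lin 2017, Prop. 2.5:
`RLCT_Ω = min_x RLCT_{Ω_x}`): if finitely many non-negative quantities `V_i(t)` satisfy
`V_i(t) / (t^{λ_i} (log 1/t)^{θ_i - 1}) → c_i > 0` as `t → 0⁺`, then their sum satisfies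
`(∑ V_i(t)) / (t^{λ_*} (log 1/t)^{θ_* - 1}) → C > 0`, where `(λ_*, θ_*)` is the lexicographically
dominant pair: `λ_*` the smallest exponent and `θ_*` the largest multiplicity among the pieces with
`λ_i = λ_*` (`tendsto_finset_sum_powerLog`); `C` is the sum of the `c_i` of the dominant pieces.

Everything is PROVED; no definitions, no named facts.

## References

* V. I. Arnold, S. M. Gusein-Zade, A. N. Varchenko, *Singularities of Differentiable Maps II*
  (2012), Part II §7.3, proof of Thm. 7.5. [ArnoldGuseinzadeVarchenko2012]
* S. Lin, arXiv:1003.5338, Prop. 2.5. [Lin2017]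
-/

noncomputable section

open Filter Set Topology

namespace Literature.Analysis.Asymptotics.MonomialPhase

/-- **Lexicographically dominant piece.** Among finitely many exponent pairs `(λ_i, θ_i)` there is
one, `i₀`, with `λ_{i₀} ≤ λ_i` for all `i` and `θ_i ≤ θ_{i₀}` whenever `λ_i = λ_{i₀}`. [folklore] -/
theorem exists_dominant {ι : Type*} (s : Finset ι) (hs : s.Nonempty) (lam : ι → ℝ) (θ : ι → ℕ) :
    ∃ i₀ ∈ s, (∀ i ∈ s, lam i₀ ≤ lam i) ∧ (∀ i ∈ s, lam i = lam i₀ → θ i ≤ θ i₀) := by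
  classical
  obtain ⟨i₁, hi₁, hmin⟩ := s.exists_min_image lam hs
  have hs' : (s.filter fun i => lam i = lam i₁).Nonempty := ⟨i₁, by simp [hi₁]⟩
  obtain ⟨i₀, hi₀, hmax⟩ := (s.filter fun i => lam i = lam i₁).exists_max_image θ hs'
  simp only [Finset.mem_filter] at hi₀ hmax
  refine ⟨i₀, hi₀.1, fun i hi => hi₀.2 ▸ hmin i hi, fun i hi hl => hmax i ⟨hi, ?_⟩⟩
  rw [hl, hi₀.2]

/-- **Finite sums of power-log asymptotic pieces**: if `V_i(t)/(t^{λ_i} (log 1/t)^{θ_i-1}) → c_i > 0`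
as `t → 0⁺` for every `i` in a nonempty finite set, then for the lexicographically dominant pair
`(λ_{i₀}, θ_{i₀})` the sum satisfies `(∑ V_i)/(t^{λ_{i₀}} (log 1/t)^{θ_{i₀}-1}) → C > 0`
(`C = ∑ {c_i : (λ_i, θ_i) = (λ_{i₀}, θ_{i₀})}`). [cite: ArnoldGuseinzadeVarchenko2012, Part II §7.3
proof of Thm. 7.5] [cite: Lin2017, Prop. 2.5] -/
theorem tendsto_finset_sum_powerLog {ι : Type*} (s : Finset ι) (hs : s.Nonempty)
    (V : ι → ℝ → ℝ) (lam : ι → ℝ) (θ : ι → ℕ) (c : ι → ℝ) (hθ : ∀ i ∈ s, 1 ≤ θ i)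
    (hc : ∀ i ∈ s, 0 < c i)
    (hV : ∀ i ∈ s, Tendsto (fun t : ℝ => V i t / (t ^ lam i * Real.log t⁻¹ ^ (θ i - 1)))
      (𝓝[>] 0) (𝓝 (c i))) :
    ∃ i₀ ∈ s, ∃ C : ℝ, 0 < C ∧ (∀ i ∈ s, lam i₀ ≤ lam i) ∧
      (∀ i ∈ s, lam i = lam i₀ → θ i ≤ θ i₀) ∧
      Tendsto (fun t : ℝ => (∑ i ∈ s, V i t) / (t ^ lam i₀ * Real.log t⁻¹ ^ (θ i₀ - 1)))
        (𝓝[>] 0) (𝓝 C) := by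
  classical
  obtain ⟨i₀, hi₀, hlam, hθle⟩ := exists_dominant s hs lam θ
  -- each piece, renormalised at the dominant scale
  have hpiece : ∀ i ∈ s, Tendsto (fun t : ℝ => V i t / (t ^ lam i₀ * Real.log t⁻¹ ^ (θ i₀ - 1)))
      (𝓝[>] 0) (𝓝 (if lam i = lam i₀ ∧ θ i = θ i₀ then c i else 0)) := by
    intro i hi
    split_ifs with h
    · rw [← h.1, ← h.2]
      exact hV i hi
    · refine tendsto_renormalize_zero (hV i hi) ?_
      rcases (hlam i hi).lt_or_eq with hlt | heq
      · exact Or.inl hlt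
      · refine Or.inr ⟨heq, ?_⟩
        have h1 := hθle i hi heq.symm
        have h2 : θ i ≠ θ i₀ := fun h' => h ⟨heq.symm, h'⟩
        have := hθ i hi
        omega
  refine ⟨i₀, hi₀, ∑ i ∈ s, (if lam i = lam i₀ ∧ θ i = θ i₀ then c i else 0), ?_, hlam, hθle, ?_⟩
  · calc (0 : ℝ) < c i₀ := hc i₀ hi₀
      _ = if lam i₀ = lam i₀ ∧ θ i₀ = θ i₀ then c i₀ else 0 := by simp
      _ ≤ ∑ i ∈ s, (if lam i = lam i₀ ∧ θ i = θ i₀ then c i else 0) :=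
          Finset.single_le_sum (f := fun i => if lam i = lam i₀ ∧ θ i = θ i₀ then c i else 0)
            (fun i hi => by
              split_ifs
              · exact (hc i hi).le
              · exact le_rfl) hi₀
  · have hsum := tendsto_finsetSum s fun i hi => hpiece i hi
    refine hsum.congr' (Eventually.of_forall fun t => ?_)
    dsimp only
    rw [Finset.sum_div]

/-- A piece vanishing near `0⁺` (e.g. the part of a sublevel volume where the phase is bounded away
from zero) does not contribute at any power-log scale. [folklore] -/
theorem tendsto_div_powerLog_of_eventually_eq_zero {V : ℝ → ℝ} {t₀ : ℝ} (ht₀ : 0 < t₀)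
    (hV : ∀ t, 0 < t → t < t₀ → V t = 0) (lam : ℝ) (m : ℕ) :
    Tendsto (fun t : ℝ => V t / (t ^ lam * Real.log t⁻¹ ^ m)) (𝓝[>] 0) (𝓝 0) := by
  refine tendsto_const_nhds.congr' ?_
  have hmem : Ioo (0 : ℝ) t₀ ∈ 𝓝[>] (0 : ℝ) := Ioo_mem_nhdsGT ht₀
  filter_upwards [hmem] with t ht
  rw [hV t ht.1 ht.2, zero_div]

end Literature.Analysis.Asymptotics.MonomialPhase

end
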